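import Mathlib
import HarnessLib
import Summits.Langlands.Statement
import Summits.Langlands.Langlands.Theses.AuxiliaryLevelSplit
import Summits.Langlands.Langlands.Theses.PrimeSwitchSplit
import Summits.Langlands.Langlands.Theorems.IwahoriTransientSplitLevelFiniteness
import Summits.Langlands.Langlands.Theorems.BanalLevelSplitIwahoriLevelConfinement
import Summits.Langlands.Langlands.Theorems.IwahoriTransientDictionaryEdgeSS

/-!
# BanalAuxiliarySplit — lens-3 gen 28 node of the cell `decomp-langlands` (planner-decomp-langlands-lens-3-g28-0, 2026-08-31)

TARGET (by name): ILC = `Summit.Langlands.Langlands.Theorems.IwahoriTransient.IwahoriLevelConfinement`, the DECLARED RESIDUAL of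
U = `Summit.Langlands.Langlands.Theses.AuxiliaryLevelSplit.LevelFiniteness` (stmt-Langlands-27042) under the gen-25 translation U ⟺ SSH ∧ ILC
(`IwahoriTransient.levelFiniteness_iff_pieces`, p822572); OR-SIBLING of the gen-26 node `BanalLevelSplit` (ILC ⟺ BNS ∧ NBC, cut at H♭ «non-banally
shaped», p823743).  THIS node cuts ILC at the mirror depth
    H♮ = `IsBanallyShapedProAutomorphic` := H♯ with every residual bad place BANAL (¬ `BanalLevel.IsNonBanalAt ℓ n v`, i.e. ℓ ∤ |GL_n(𝔽_q)|, q = q_v: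
    `isNonBanalAt_iff_dvd_card_GL` via Mathlib `Matrix.card_GL_field`; n = 2: q_v ≢ 0, ±1 mod ℓ, `isNonBanalAt_two_iff`);   ladder C ⟹ H♮ ⟹ H♯ ⟹ H∞.
THE ONE CERTIFIED TRANSLATION (kernel `confinement_iff_banalAuxPieces`, modulo NOTHING):   ILC ⟺ AuxiliaryBanality ∧ BanalConfinement;   hence
U ⟺ SSH ∧ AUXB ∧ BNC (`levelFiniteness_iff_banalAuxPieces`).
  • AUXB = `AuxiliaryBanality` : H♯ ⟹ H♮ — «the wandering auxiliary Iwahori level of deep approximants can be RE-CHOSEN at banal places»: a GALOIS-SIDE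
    statement (banal Selmer-annihilating auxiliary primes: Ramakrishna / Khare–Ramakrishna nice primes q ≢ ±1 mod ℓ [arXiv:math/0210296 p.2–3;
    arXiv:math/0211006 p.3,5,6], Camporino–Pacetti Thm A [arXiv:1312.4925 p.3, §5] — banal for n = 2; for n ≥ 3 Fakhruddin–Khare–Patrikis use TRIVIAL
    primes q ≡ 1 mod ℓ [arXiv:1904.02374 p.6–7]: IDEA-NEEDED; l₀ > 0: BARRIER).  DECLARED RESIDUAL; WEAKER than ILC (`auxiliaryBanality_of_confinement`).
  • BNC = `BanalConfinement` : H♮ ⟹ C — level lowering CONFINED TO BANAL Iwahori places (Mazur's principle in every dimension: Boyer, Math. Z. 2026,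
    Thm 5.5; Jarvis; mod ℓ^m: Dummigan = Tsaknias–Wiese Thm 15 [arXiv:1612.05017 p.9]; banal Ihara: arXiv:2504.07504 Thm 1.2).  Deciding, ATTACKABLE,
    IDEA-NEEDED (weak ⟹ strong at free weight); WEAKER than ILC (`banalConfinement_of_confinement`); PROVED on the void-dial sector ℓ ≤ n + 1
    (`banalConfinement_smallPrimes`), where AUXB = ILC (`auxiliaryBanality_smallPrimes_iff`).
WHY NOT GEN 26 FLIPPED: gen 26 keeps the residual AUTOMORPHIC (NBC: lower non-banal level — Ihara, open n ≥ 3, open mod ℓ^m even for GL₂/ℚ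
[arXiv:1612.05017 p.4]); this node never lowers a non-banal level — the residual is GALOIS-side prime SELECTION, as in the mod-p^n literature (loc. cit. p.10).
No EXCESS: both pieces follow from ILC, U, FERN, B_w = 17414 and the summit (§6).  Separation: §8 (gen-26 toy worlds by name).  Relation to gen 26: §9.
Frames (§5, §10): `closes_residual : AUXB → BNC → ILC`, `closes_target3 : SSH → AUXB → BNC → U`, `closes_parent_banalAux` (→ FERN), `closes_root_banalAux`
(→ summit), `levelFiniteness_of_ssHost_banalAux` (hosts + dictionary → AUXB → BNC → U via the landed DAG edge p828110).  0 sorry; axioms standard.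
Full record: cell decomp-langlands, HOME/lens-3/g28/bas/memo.md.
-/

set_option linter.dupNamespace false
set_option linter.unusedVariables false

namespace Summit.Langlands.Langlands.Theorems.BanalAuxiliary

open scoped NumberField Polynomial
open Filter Field IsDedekindDomain
open Literature.NumberTheory.GaloisRepresentations Literature.NumberTheory.Automorphic
open Summit.Langlands.Langlands.Theorems.TransientLevel
open Summit.Langlands.Langlands.Theorems.IwahoriTransient

/-! ## 1. Vocabulary (the NEW intermediate language H♮; everything else is imported BY NAME) -/

section Vocabulary

variable {K : Type} [Field K] [NumberField K] {n : ℕ} {ℓ : ℕ} [Fact ℓ.Prime]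

/-- H♮ · BANALLY SHAPED PRO-AUTOMORPHIC (the NEW intermediate language of this node): ONE finite `S₀` such that for every radius `r > 0`
some L-algebraic cuspidal `π` is `r`-close to `ρ` at almost all places and, at EVERY `v ∉ S₀`, either `r`-close to `ρ` at `v`, or
Iwahori-spherical at `v` with `ρ` level-raising at `v` modulo `r` AND `v` BANAL for `(ℓ, n)` (`¬ BanalLevel.IsNonBanalAt ℓ n v`: `ℓ ∤ q_v` and
`ℓ ∤ q_vⁱ − 1` for `1 ≤ i ≤ n`).  H♯ = the same without the banality clause; H♭ (gen 26) = the same with NON-banal instead. -/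
def IsBanallyShapedProAutomorphic (hcpt : isCompact_glFiniteIntegralLevel n K) (ι : PadicAlgCl ℓ ≃+* ℂ)
    (ρ : FramedGaloisRep K (PadicAlgCl ℓ) n) : Prop :=
  ∃ S₀ : Set (HeightOneSpectrum (𝓞 K)), S₀.Finite ∧ ∀ r : NNReal, 0 < r →
    ∃ π : CuspidalAutomorphicRepData n K hcpt, π.1.IsLAlgebraic ∧
      (∀ᶠ v : HeightOneSpectrum (𝓞 K) in cofinite, CloseAt ι π ρ r v) ∧
      ∀ v : HeightOneSpectrum (𝓞 K), v ∉ S₀ →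
        CloseAt ι π ρ r v ∨ (IsIwahoriSphericalAt π v ∧ IsLevelRaisingAt ρ r v ∧ ¬ BanalLevel.IsNonBanalAt ℓ n v)

end Vocabulary

/-! ## 2. The items (one-line texts = the route kit VERBATIM; generated from the TREE texts of BNS / NBC by negating the banality clause) -/

/-- AUXB · AUXILIARY BANALITY · crux rank 3 of the split (declared residual) · WEAKER than ILC (`auxiliaryBanality_of_confinement`) · OPEN ·
Galois side: banal Selmer-annihilating auxiliary primes (n = 2: Ramakrishna–Khare «nice primes», print; n ≥ 3: idea-needed).  ILC's binders and
hypothesis H♯ VERBATIM; conclusion H♮ instead of C. -/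
def AuxiliaryBanality : Prop :=
  ∀ (K : Type) [Field K] [NumberField K] (n : ℕ) (hcpt : Literature.NumberTheory.Automorphic.isCompact_glFiniteIntegralLevel n K), 0 < n → ∀ (ℓ : ℕ) [Fact ℓ.Prime] (ι : PadicAlgCl ℓ ≃+* ℂ) (ρ : Literature.NumberTheory.GaloisRepresentations.FramedGaloisRep K (PadicAlgCl ℓ) n), ρ.toGaloisRep.IsIrreducible → ((∀ᶠ v : IsDedekindDomain.HeightOneSpectrum (NumberField.RingOfIntegers K) in Filter.cofinite, ρ.IsUnramifiedAt v) ∧ ∀ (v : IsDedekindDomain.HeightOneSpectrum (NumberField.RingOfIntegers K)) (hv : ((ℓ : ℕ) : NumberField.RingOfIntegers K) ∈ v.asIdeal), (Literature.NumberTheory.PAdicHodge.fontainePstAdicCompletion v ℓ hv).IsDeRhamFramed (ρ.toLocal v)) → (∃ S₀ : Set (IsDedekindDomain.HeightOneSpectrum (NumberField.RingOfIntegers K)), S₀.Finite ∧ ∀ r : NNReal, 0 < r → ∃ π : Literature.NumberTheory.Automorphic.CuspidalAutomorphicRepData n K hcpt, π.1.IsLAlgebraic ∧ (∀ᶠ v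 : IsDedekindDomain.HeightOneSpectrum (NumberField.RingOfIntegers K) in Filter.cofinite, (∃ α : Multiset ℂ, π.1.HasSatakeParamAt v α ∧ ∀ 𝔓 ∈ v.primesAbove, ∀ σ : Field.absoluteGaloisGroup K, IsArithFrobAt (NumberField.RingOfIntegers K) σ 𝔓 → ∀ i : ℕ, Valued.v ((Literature.NumberTheory.GaloisRepresentations.FramedRep.charpoly ρ σ - Literature.NumberTheory.Automorphic.arithFrobPolyOfSatake ι v.residueCard 1 α).coeff i) < r)) ∧ ∀ v : IsDedekindDomain.HeightOneSpectrum (NumberField.RingOfIntegers K), v ∉ S₀ → (∃ α : Multiset ℂ, π.1.HasSatakeParamAt v α ∧ ∀ 𝔓 ∈ v.primesAbove, ∀ σ : Field.absoluteGaloisGroup K, IsArithFrobAt (NumberField.RingOfIntegers K) σ 𝔓 → ∀ i : ℕ, Valued.v ((Literature.NumberTheory.GaloisRepresentations.FramedRep.charpoly ρ σ - Literature.NumberTheory.Automorphic.arithFrobPolyOfSatake ι v.residueCard 1 α).coeff i) < r) ∨ ((∃ πv : Literature.NumberTheory.Automorphic.SmoothIrrep (Matrix.GeneralLinearGroup (Fin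 n) (v.adicCompletion K)), π.1.HasLocalComponentAt v πv.ρ ∧ ∃ w : πv.V, w ≠ 0 ∧ ∀ g ∈ Literature.NumberTheory.Automorphic.iwahoriGL n (v.adicCompletion K), πv.ρ g w = w) ∧ (∀ 𝔓 ∈ v.primesAbove, ∀ σ : Field.absoluteGaloisGroup K, IsArithFrobAt (NumberField.RingOfIntegers K) σ 𝔓 → ∃ a b : PadicAlgCl ℓ, ({a, b} : Multiset (PadicAlgCl ℓ)) ≤ (Literature.NumberTheory.GaloisRepresentations.FramedRep.charpoly ρ σ).roots ∧ Valued.v (a - (v.residueCard : PadicAlgCl ℓ) * b) < r))) → ∃ S₀ : Set (IsDedekindDomain.HeightOneSpectrum (NumberField.RingOfIntegers K)), S₀.Finite ∧ ∀ r : NNReal, 0 < r → ∃ π : Literature.NumberTheory.Automorphic.CuspidalAutomorphicRepData n K hcpt, π.1.IsLAlgebraic ∧ (∀ᶠ v : IsDedekindDomain.HeightOneSpectrum (NumberField.RingOfIntegers K) in Filter.cofinite, (∃ α : Multiset ℂ, π.1.HasSatakeParamAt v α ∧ ∀ 𝔓 ∈ v.primesAbove, ∀ σ : Field.absoluteGaloisGroup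 K, IsArithFrobAt (NumberField.RingOfIntegers K) σ 𝔓 → ∀ i : ℕ, Valued.v ((Literature.NumberTheory.GaloisRepresentations.FramedRep.charpoly ρ σ - Literature.NumberTheory.Automorphic.arithFrobPolyOfSatake ι v.residueCard 1 α).coeff i) < r)) ∧ ∀ v : IsDedekindDomain.HeightOneSpectrum (NumberField.RingOfIntegers K), v ∉ S₀ → (∃ α : Multiset ℂ, π.1.HasSatakeParamAt v α ∧ ∀ 𝔓 ∈ v.primesAbove, ∀ σ : Field.absoluteGaloisGroup K, IsArithFrobAt (NumberField.RingOfIntegers K) σ 𝔓 → ∀ i : ℕ, Valued.v ((Literature.NumberTheory.GaloisRepresentations.FramedRep.charpoly ρ σ - Literature.NumberTheory.Automorphic.arithFrobPolyOfSatake ι v.residueCard 1 α).coeff i) < r) ∨ ((∃ πv : Literature.NumberTheory.Automorphic.SmoothIrrep (Matrix.GeneralLinearGroup (Fin n) (v.adicCompletion K)), π.1.HasLocalComponentAt v πv.ρ ∧ ∃ w : πv.V, w ≠ 0 ∧ ∀ g ∈ Literature.NumberTheory.Automorphic.iwahoriGL n (v.adicCompletion K), πv.ρ g w = w) ∧ (∀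 𝔓 ∈ v.primesAbove, ∀ σ : Field.absoluteGaloisGroup K, IsArithFrobAt (NumberField.RingOfIntegers K) σ 𝔓 → ∃ a b : PadicAlgCl ℓ, ({a, b} : Multiset (PadicAlgCl ℓ)) ≤ (Literature.NumberTheory.GaloisRepresentations.FramedRep.charpoly ρ σ).roots ∧ Valued.v (a - (v.residueCard : PadicAlgCl ℓ) * b) < r) ∧ ¬ (ℓ ∣ v.residueCard ∨ ∃ i : ℕ, 1 ≤ i ∧ i ≤ n ∧ ℓ ∣ v.residueCard ^ i - 1))

/-- BNC · BANAL CONFINEMENT · crux rank 2 of the split (deciding) · WEAKER than ILC (`banalConfinement_of_confinement`) · OPEN · ATTACKABLE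
(Mazur's principle at banal places in every dimension; banal Ihara known) · IDEA-NEEDED (weak ⟹ strong at free weight).  ILC's text VERBATIM
with the hypothesis H♯ REPLACED by H♮. -/
def BanalConfinement : Prop :=
  ∀ (K : Type) [Field K] [NumberField K] (n : ℕ) (hcpt : Literature.NumberTheory.Automorphic.isCompact_glFiniteIntegralLevel n K), 0 < n → ∀ (ℓ : ℕ) [Fact ℓ.Prime] (ι : PadicAlgCl ℓ ≃+* ℂ) (ρ : Literature.NumberTheory.GaloisRepresentations.FramedGaloisRep K (PadicAlgCl ℓ) n), ρ.toGaloisRep.IsIrreducible → ((∀ᶠ v : IsDedekindDomain.HeightOneSpectrum (NumberField.RingOfIntegers K) in Filter.cofinite, ρ.IsUnramifiedAt v) ∧ ∀ (v : IsDedekindDomain.HeightOneSpectrum (NumberField.RingOfIntegers K)) (hv : ((ℓ : ℕ) : NumberField.RingOfIntegers K) ∈ v.asIdeal), (Literature.NumberTheory.PAdicHodge.fontainePstAdicCompletion v ℓ hv).IsDeRhamFramed (ρ.toLocal v)) → (∃ S₀ : Set (IsDedekindDomain.HeightOneSpectrum (NumberField.RingOfIntegers K)), S₀.Finite ∧ ∀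 r : NNReal, 0 < r → ∃ π : Literature.NumberTheory.Automorphic.CuspidalAutomorphicRepData n K hcpt, π.1.IsLAlgebraic ∧ (∀ᶠ v : IsDedekindDomain.HeightOneSpectrum (NumberField.RingOfIntegers K) in Filter.cofinite, (∃ α : Multiset ℂ, π.1.HasSatakeParamAt v α ∧ ∀ 𝔓 ∈ v.primesAbove, ∀ σ : Field.absoluteGaloisGroup K, IsArithFrobAt (NumberField.RingOfIntegers K) σ 𝔓 → ∀ i : ℕ, Valued.v ((Literature.NumberTheory.GaloisRepresentations.FramedRep.charpoly ρ σ - Literature.NumberTheory.Automorphic.arithFrobPolyOfSatake ι v.residueCard 1 α).coeff i) < r)) ∧ ∀ v : IsDedekindDomain.HeightOneSpectrum (NumberField.RingOfIntegers K), v ∉ S₀ → (∃ α : Multiset ℂ, π.1.HasSatakeParamAt v α ∧ ∀ 𝔓 ∈ v.primesAbove, ∀ σ : Field.absoluteGaloisGroup K, IsArithFrobAt (NumberField.RingOfIntegers K) σ 𝔓 → ∀ i : ℕ, Valued.v ((Literature.NumberTheory.GaloisRepresentations.FramedRep.charpoly ρ σ - Literature.NumberTheory.Automorphic.arithFrobPolyOfSatake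 ι v.residueCard 1 α).coeff i) < r) ∨ ((∃ πv : Literature.NumberTheory.Automorphic.SmoothIrrep (Matrix.GeneralLinearGroup (Fin n) (v.adicCompletion K)), π.1.HasLocalComponentAt v πv.ρ ∧ ∃ w : πv.V, w ≠ 0 ∧ ∀ g ∈ Literature.NumberTheory.Automorphic.iwahoriGL n (v.adicCompletion K), πv.ρ g w = w) ∧ (∀ 𝔓 ∈ v.primesAbove, ∀ σ : Field.absoluteGaloisGroup K, IsArithFrobAt (NumberField.RingOfIntegers K) σ 𝔓 → ∃ a b : PadicAlgCl ℓ, ({a, b} : Multiset (PadicAlgCl ℓ)) ≤ (Literature.NumberTheory.GaloisRepresentations.FramedRep.charpoly ρ σ).roots ∧ Valued.v (a - (v.residueCard : PadicAlgCl ℓ) * b) < r) ∧ ¬ (ℓ ∣ v.residueCard ∨ ∃ i : ℕ, 1 ≤ i ∧ i ≤ n ∧ ℓ ∣ v.residueCard ^ i - 1))) → ∃ S : Set (IsDedekindDomain.HeightOneSpectrum (NumberField.RingOfIntegers K)), S.Finite ∧ ∀ r : NNReal, 0 < r → ∃ π : Literature.NumberTheory.Automorphic.CuspidalAutomorphicRepData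 n K hcpt, π.1.IsLAlgebraic ∧ ∀ v : IsDedekindDomain.HeightOneSpectrum (NumberField.RingOfIntegers K), v ∉ S → (∃ α : Multiset ℂ, π.1.HasSatakeParamAt v α ∧ ∀ 𝔓 ∈ v.primesAbove, ∀ σ : Field.absoluteGaloisGroup K, IsArithFrobAt (NumberField.RingOfIntegers K) σ 𝔓 → ∀ i : ℕ, Valued.v ((Literature.NumberTheory.GaloisRepresentations.FramedRep.charpoly ρ σ - Literature.NumberTheory.Automorphic.arithFrobPolyOfSatake ι v.residueCard 1 α).coeff i) < r)

/-- ResidualAssembly (curried deciding theorem of the split of the residual): AUXB → BNC → ILC. -/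
def ResidualAssembly : Prop :=
  AuxiliaryBanality → BanalConfinement → IwahoriLevelConfinement

/-- ChildAssembly3 (curried deciding theorem of the three-binder child of U): SSH → AUXB → BNC → U. -/
def ChildAssembly3 : Prop :=
  SemistableShaping → AuxiliaryBanality → BanalConfinement → Summit.Langlands.Langlands.Theses.AuxiliaryLevelSplit.LevelFiniteness

/-! ## 3. Structured readings (all `Iff.rfl`: the one-liners ARE the structured statements) -/

/-- AUXB unfolded (semistably shaped ⇒ banally shaped). -/
theorem auxiliaryBanality_iff : AuxiliaryBanality ↔
    ∀ (K : Type) [Field K] [NumberField K] (n : ℕ) (hcpt : isCompact_glFiniteIntegralLevel n K), 0 < n →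
      ∀ (ℓ : ℕ) [Fact ℓ.Prime] (ι : PadicAlgCl ℓ ≃+* ℂ) (ρ : FramedGaloisRep K (PadicAlgCl ℓ) n),
        ρ.toGaloisRep.IsIrreducible → IsPinnedGeometric ρ →
        IsShapedProAutomorphic hcpt ι ρ → IsBanallyShapedProAutomorphic hcpt ι ρ :=
  Iff.rfl

/-- BNC unfolded (banally shaped ⇒ pro-automorphic of bounded level). -/
theorem banalConfinement_iff : BanalConfinement ↔
    ∀ (K : Type) [Field K] [NumberField K] (n : ℕ) (hcpt : isCompact_glFiniteIntegralLevel n K), 0 < n →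
      ∀ (ℓ : ℕ) [Fact ℓ.Prime] (ι : PadicAlgCl ℓ ≃+* ℂ) (ρ : FramedGaloisRep K (PadicAlgCl ℓ) n),
        ρ.toGaloisRep.IsIrreducible → IsPinnedGeometric ρ →
        IsBanallyShapedProAutomorphic hcpt ι ρ → IsProAutomorphic hcpt ι ρ :=
  Iff.rfl

/-! ## 4. Kernel lemmas on the ladder of depths  H∞ ⟸ H♯ ⟸ H♮ ⟸ C  (and H♮ vs the gen-26 rung H♭) -/

section Kernel

variable {K : Type} [Field K] [NumberField K] {n : ℕ} {hcpt : isCompact_glFiniteIntegralLevel n K} {ℓ : ℕ} [Fact ℓ.Prime]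
  {ι : PadicAlgCl ℓ ≃+* ℂ} {ρ : FramedGaloisRep K (PadicAlgCl ℓ) n}

/-- H♮ ⇒ H♯: forget the banality clause. -/
theorem shaped_of_banallyShaped (h : IsBanallyShapedProAutomorphic hcpt ι ρ) : IsShapedProAutomorphic hcpt ι ρ := by
  obtain ⟨S₀, hS₀, h⟩ := h
  refine ⟨S₀, hS₀, fun r hr => ?_⟩
  obtain ⟨π, hπ, hae, hsh⟩ := h r hr
  exact ⟨π, hπ, hae, fun v hv => (hsh v hv).imp_right fun h' => ⟨h'.1, h'.2.1⟩⟩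

/-- C ⇒ H♮: one finite `S` good for every radius is a fortiori a banal shaping set (first disjunct everywhere off `S`). -/
theorem banallyShaped_of_pro (h : IsProAutomorphic hcpt ι ρ) : IsBanallyShapedProAutomorphic hcpt ι ρ := by
  obtain ⟨S, hS, h⟩ := h
  refine ⟨S, hS, fun r hr => ?_⟩
  obtain ⟨π, hπ, hclose⟩ := h r hr
  refine ⟨π, hπ, Filter.eventually_cofinite.mpr (hS.subset fun w hw => ?_), fun v hv => Or.inl (hclose v hv)⟩
  by_contra hwS
  exact hw (hclose w hwS)

end Kernel

/-! ## 5. The node: deciding theorems, necessity from the target, THE ONE EQUIV -/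

/-- DECIDING THEOREM of the split of the residual: AUXB → BNC → ILC, concluding ILC BY NAME; both binders used. -/
theorem closes_residual (h₁ : AuxiliaryBanality) (h₂ : BanalConfinement) : IwahoriLevelConfinement := by
  intro K _ _ n hcpt hn ℓ _ ι ρ hirr hgeo hsh
  exact h₂ K n hcpt hn ℓ ι ρ hirr hgeo (h₁ K n hcpt hn ℓ ι ρ hirr hgeo hsh)

/-- The curried residual assembly Prop is inhabited. -/
theorem residualAssembly_proof : ResidualAssembly := fun h₁ h₂ => closes_residual h₁ h₂

/-- DECIDING THEOREM of the three-binder child route of U (D-0027 §2.1): SSH → AUXB → BNC → U, U by name, all three binders used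
(through the gen-25 tree theorem `IwahoriTransient.closes_target`). -/
theorem closes_target3 (hS : SemistableShaping) (h₁ : AuxiliaryBanality) (h₂ : BanalConfinement) :
    Summit.Langlands.Langlands.Theses.AuxiliaryLevelSplit.LevelFiniteness :=
  Summit.Langlands.Langlands.Theorems.IwahoriTransient.closes_target hS (closes_residual h₁ h₂)

/-- The curried child assembly Prop is inhabited. -/
theorem childAssembly3_proof : ChildAssembly3 := fun hS h₁ h₂ => closes_target3 hS h₁ h₂

/-- NECESSITY: ILC ⇒ AUXB (bounded level is a fortiori banally shaped: C ⇒ H♮). -/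
theorem auxiliaryBanality_of_confinement (h : IwahoriLevelConfinement) : AuxiliaryBanality := by
  intro K _ _ n hcpt hn ℓ _ ι ρ hirr hgeo hsh
  exact banallyShaped_of_pro (h K n hcpt hn ℓ ι ρ hirr hgeo hsh)

/-- NECESSITY: ILC ⇒ BNC (H♮ ⇒ H♯, then ILC). -/
theorem banalConfinement_of_confinement (h : IwahoriLevelConfinement) : BanalConfinement := by
  intro K _ _ n hcpt hn ℓ _ ι ρ hirr hgeo hnat
  exact h K n hcpt hn ℓ ι ρ hirr hgeo (shaped_of_banallyShaped hnat)

/-- THE ONE EQUIV of the node (lens-3): ILC ⟺ AUXB ∧ BNC, modulo NOTHING. -/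
theorem confinement_iff_banalAuxPieces : IwahoriLevelConfinement ↔ AuxiliaryBanality ∧ BanalConfinement :=
  ⟨fun h => ⟨auxiliaryBanality_of_confinement h, banalConfinement_of_confinement h⟩, fun h => closes_residual h.1 h.2⟩

/-- NECESSITY from U: U ⇒ AUXB. -/
theorem auxiliaryBanality_of_levelFiniteness (hU : Summit.Langlands.Langlands.Theses.AuxiliaryLevelSplit.LevelFiniteness) :
    AuxiliaryBanality :=
  auxiliaryBanality_of_confinement (confinement_of_levelFiniteness hU)

/-- NECESSITY from U: U ⇒ BNC. -/
theorem banalConfinement_of_levelFiniteness (hU : Summit.Langlands.Langlands.Theses.AuxiliaryLevelSplit.LevelFiniteness) :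
    BanalConfinement :=
  banalConfinement_of_confinement (confinement_of_levelFiniteness hU)

/-- THREE-PIECE READING of the lineage target: U ⟺ SSH ∧ AUXB ∧ BNC (exact; SSH = the gen-25 tree decl BY NAME; the composite of the gen-25
certified U ⟺ SSH ∧ ILC with THE ONE EQUIV above). -/
theorem levelFiniteness_iff_banalAuxPieces :
    Summit.Langlands.Langlands.Theses.AuxiliaryLevelSplit.LevelFiniteness ↔ SemistableShaping ∧ AuxiliaryBanality ∧ BanalConfinement :=
  ⟨fun h => ⟨shaping_of_levelFiniteness h, auxiliaryBanality_of_levelFiniteness h, banalConfinement_of_levelFiniteness h⟩,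
    fun h => closes_target3 h.1 h.2.1 h.2.2⟩

/-! ## 6. Necessity from FERN (25024), from B_w (17414, by name) and from the summit — no EXCESS -/

/-- AUXB is FERN-implied. -/
theorem auxiliaryBanality_of_fernSpread (hF : Summit.Langlands.Langlands.Theses.DepthPrimeSplit.FernSpread) : AuxiliaryBanality :=
  auxiliaryBanality_of_confinement (iwahoriLevelConfinement_of_fernSpread hF)

/-- BNC is FERN-implied. -/
theorem banalConfinement_of_fernSpread (hF : Summit.Langlands.Langlands.Theses.DepthPrimeSplit.FernSpread) : BanalConfinement :=
  banalConfinement_of_confinement (iwahoriLevelConfinement_of_fernSpread hF)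

/-- AUXB is B_w-implied. -/
theorem auxiliaryBanality_of_weak (hB : Summit.Langlands.Langlands.Theses.PrimeSwitchSplit.WeakGeometricAutomorphy) : AuxiliaryBanality :=
  auxiliaryBanality_of_confinement (iwahoriLevelConfinement_of_weak hB)

/-- BNC is B_w-implied. -/
theorem banalConfinement_of_weak (hB : Summit.Langlands.Langlands.Theses.PrimeSwitchSplit.WeakGeometricAutomorphy) : BanalConfinement :=
  banalConfinement_of_confinement (iwahoriLevelConfinement_of_weak hB)

/-- AUXB is implied by the summit. -/
theorem auxiliaryBanality_of_langlands (hL : _root_.Langlands) : AuxiliaryBanality :=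
  auxiliaryBanality_of_confinement (iwahoriLevelConfinement_of_langlands hL)

/-- BNC is implied by the summit. -/
theorem banalConfinement_of_langlands (hL : _root_.Langlands) : BanalConfinement :=
  banalConfinement_of_confinement (iwahoriLevelConfinement_of_langlands hL)

/-- ROOT-IMPLIED certificate for the whole three-binder child: the summit implies all three pieces. -/
theorem banalAuxPieces_of_langlands (hL : _root_.Langlands) : SemistableShaping ∧ AuxiliaryBanality ∧ BanalConfinement :=
  ⟨semistableShaping_of_langlands hL, auxiliaryBanality_of_langlands hL, banalConfinement_of_langlands hL⟩

/-! ## 7. Dictionary: the banality clause IS print's «ℓ ∤ |GL_n(𝔽_q)|» (Vignéras; the banal Ihara lemma) for n ≥ 2, and for n = 2 it is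
Ramakrishna's «nice prime» condition q ≢ 0, ±1 (mod ℓ) -/

section Dictionary

variable {K : Type} [Field K] [NumberField K]

/-- Pure arithmetic: for a prime `ℓ` and `n ≥ 2`, `ℓ ∣ q ∨ ∃ 1 ≤ i ≤ n, ℓ ∣ qⁱ − 1` iff `ℓ ∣ ∏_{i<n} (qⁿ − qⁱ)` (= `|GL_n(𝔽_q)|`). -/
theorem prime_dvd_prod_pow_sub_pow_iff {ℓ n q : ℕ} (hℓ : ℓ.Prime) (hn : 2 ≤ n) :
    (ℓ ∣ q ∨ ∃ i : ℕ, 1 ≤ i ∧ i ≤ n ∧ ℓ ∣ q ^ i - 1) ↔ ℓ ∣ ∏ i : Fin n, (q ^ n - q ^ (i : ℕ)) := by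
  have key : ∀ j : ℕ, j ≤ n → q ^ n - q ^ j = q ^ j * (q ^ (n - j) - 1) := fun j hj => by
    rw [mul_tsub, mul_one, ← pow_add, Nat.add_sub_cancel' hj]
  constructor
  · rintro (hq | ⟨i, hi1, hin, hdvd⟩)
    · have h1 : ℓ ∣ q ^ n - q ^ ((⟨1, by omega⟩ : Fin n) : ℕ) := by
        show ℓ ∣ q ^ n - q ^ 1
        rw [key 1 (by omega)]
        exact (hq.trans (dvd_pow_self q one_ne_zero)).mul_right _
      exact h1.trans (Finset.dvd_prod_of_mem _ (Finset.mem_univ _))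
    · have h1 : ℓ ∣ q ^ n - q ^ ((⟨n - i, by omega⟩ : Fin n) : ℕ) := by
        show ℓ ∣ q ^ n - q ^ (n - i)
        rw [key (n - i) (by omega), Nat.sub_sub_self hin]
        exact hdvd.mul_left _
      exact h1.trans (Finset.dvd_prod_of_mem _ (Finset.mem_univ _))
  · intro h
    obtain ⟨j, -, hj⟩ := (hℓ.prime.dvd_finsetProd_iff _).mp h
    have hjn := j.isLt
    rw [key j (le_of_lt hjn)] at hj
    rcases (Nat.Prime.dvd_mul hℓ).mp hj with hq | hr
    · exact Or.inl (hℓ.dvd_of_dvd_pow hq)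
    · exact Or.inr ⟨n - j, by omega, by omega, hr⟩

/-- DICTIONARY (n ≥ 2): `v` is non-banal for `(ℓ, n)` iff `ℓ ∣ ∏_{i<n} (q_vⁿ − q_vⁱ)`. -/
theorem isNonBanalAt_iff_dvd_prod {ℓ n : ℕ} (hℓ : ℓ.Prime) (hn : 2 ≤ n) (v : HeightOneSpectrum (𝓞 K)) :
    BanalLevel.IsNonBanalAt ℓ n v ↔ ℓ ∣ ∏ i : Fin n, (v.residueCard ^ n - v.residueCard ^ (i : ℕ)) :=
  prime_dvd_prod_pow_sub_pow_iff hℓ hn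

/-- DICTIONARY with Mathlib's `Matrix.card_GL_field` (n ≥ 2): `v` is non-banal for `(ℓ, n)` iff `ℓ` divides the order of `GL_n(𝔽)` for any
finite field `𝔽` of cardinality `q_v` — Vignéras' banal/non-banal dichotomy and the hypothesis «ℓ ∤ |GL_n(𝔽_q)|» of the banal Ihara lemma. -/
theorem isNonBanalAt_iff_dvd_card_GL {ℓ n : ℕ} (hℓ : ℓ.Prime) (hn : 2 ≤ n) (v : HeightOneSpectrum (𝓞 K))
    (𝔽 : Type*) [Field 𝔽] [Fintype 𝔽] (h𝔽 : Fintype.card 𝔽 = v.residueCard) :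
    BanalLevel.IsNonBanalAt ℓ n v ↔ ℓ ∣ Nat.card (Matrix.GeneralLinearGroup (Fin n) 𝔽) := by
  rw [Matrix.card_GL_field, h𝔽]
  exact prime_dvd_prod_pow_sub_pow_iff hℓ hn

/-- n = 2 (prime ℓ): non-banal ⟺ `ℓ ∣ q_v ∨ ℓ ∣ q_v − 1 ∨ ℓ ∣ q_v + 1`, i.e. q_v ≡ 0, 1, −1 (mod ℓ).  So for v ∤ ℓ the BANAL places of GL₂ are
exactly Ramakrishna's «nice» auxiliary primes q ≢ ±1 (mod ℓ) (Khare–Ramakrishna; Camporino–Pacetti Thm A), and Dummigan's level-lowering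
hypothesis p ≢ 1 (mod ℓ) is implied. -/
theorem isNonBanalAt_two_iff {ℓ : ℕ} (hℓ : ℓ.Prime) (v : HeightOneSpectrum (𝓞 K)) :
    BanalLevel.IsNonBanalAt ℓ 2 v ↔ ℓ ∣ v.residueCard ∨ ℓ ∣ v.residueCard - 1 ∨ ℓ ∣ v.residueCard + 1 := by
  have hsq : ∀ q : ℕ, q ^ 2 - 1 = (q + 1) * (q - 1) := by
    intro q
    obtain _ | q := q
    · simp
    · simp only [Nat.add_sub_cancel]
      apply Nat.sub_eq_of_eq_add
      ring
  unfold BanalLevel.IsNonBanalAt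
  constructor
  · rintro (h | ⟨i, hi1, hi2, h⟩)
    · exact Or.inl h
    · interval_cases i
      · exact Or.inr (Or.inl (by simpa using h))
      · rw [hsq] at h
        rcases (Nat.Prime.dvd_mul hℓ).mp h with h' | h'
        · exact Or.inr (Or.inr h')
        · exact Or.inr (Or.inl h')
  · rintro (h | h | h)
    · exact Or.inl h
    · exact Or.inr ⟨1, le_rfl, by omega, by simpa using h⟩
    · exact Or.inr ⟨2, by omega, le_rfl, by rw [hsq]; exact h.mul_right _⟩

end Dictionary

/-! ## 7b. The void-dial sector ℓ ≤ n + 1: no place is banal (`BanalLevel.isNonBanalAt_of_le`), so H♮ ⟺ C there, BNC is PROVED there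
(typed BC5-style rung of the deciding piece, content-free) and AUXB = ILC there -/

section SmallPrimes

variable {K : Type} [Field K] [NumberField K] {n : ℕ} {hcpt : isCompact_glFiniteIntegralLevel n K} {ℓ : ℕ} [Fact ℓ.Prime]
  {ι : PadicAlgCl ℓ ≃+* ℂ} {ρ : FramedGaloisRep K (PadicAlgCl ℓ) n}

/-- For prime `ℓ ≤ n + 1`, H♮ ⟺ C (the banal disjunct is empty). -/
theorem banallyShaped_iff_pro_of_le (hle : ℓ ≤ n + 1) : IsBanallyShapedProAutomorphic hcpt ι ρ ↔ IsProAutomorphic hcpt ι ρ := by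
  refine ⟨fun h => ?_, banallyShaped_of_pro⟩
  obtain ⟨S₀, hS₀, h⟩ := h
  refine ⟨S₀, hS₀, fun r hr => ?_⟩
  obtain ⟨π, hπ, -, hsh⟩ := h r hr
  exact ⟨π, hπ, fun v hv => (hsh v hv).elim id fun hb => (hb.2.2 (BanalLevel.isNonBanalAt_of_le (Fact.out : ℓ.Prime) hle v)).elim⟩

/-- For prime `ℓ ≤ n + 1`, AUXB restricted = ILC restricted (pointwise): the residual keeps everything there. -/
theorem auxiliaryBanality_smallPrimes_iff (hle : ℓ ≤ n + 1) :
    (IsShapedProAutomorphic hcpt ι ρ → IsBanallyShapedProAutomorphic hcpt ι ρ) ↔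
      (IsShapedProAutomorphic hcpt ι ρ → IsProAutomorphic hcpt ι ρ) := by
  rw [banallyShaped_iff_pro_of_le hle]

end SmallPrimes

/-- RUNG · BNC on the void-dial sector, PROVED: for every K, n ≥ 1, prime ℓ ≤ n + 1, ι and every irreducible pinned-geometric ρ,
banally shaped ⇒ pro-automorphic of bounded level.  (ILC, U and the summit are NOT known on this sector; the rung is content-free — no place is
banal — and records that BNC is strictly smaller than ILC in scope: on this sector AUXB carries ALL of ILC, `auxiliaryBanality_smallPrimes_iff`.) -/
theorem banalConfinement_smallPrimes :
    ∀ (K : Type) [Field K] [NumberField K] (n : ℕ) (hcpt : isCompact_glFiniteIntegralLevel n K), 0 < n →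
      ∀ (ℓ : ℕ) [Fact ℓ.Prime] (ι : PadicAlgCl ℓ ≃+* ℂ) (ρ : FramedGaloisRep K (PadicAlgCl ℓ) n), ℓ ≤ n + 1 →
        ρ.toGaloisRep.IsIrreducible → IsPinnedGeometric ρ →
        IsBanallyShapedProAutomorphic hcpt ι ρ → IsProAutomorphic hcpt ι ρ := by
  intro K _ _ n hcpt hn ℓ _ ι ρ hle _hirr _hgeo h
  exact (banallyShaped_iff_pro_of_le hle).mp h

/-! ## 8. MODEL WITNESSES of separation — the gen-26 toy worlds BY NAME, with the place predicate read as «banal»: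
`BanalLevel.ToyFlat close bad bn S₀` with `bn` = banality is toy-H♮.  All-banal world (`bn = True`): the AUXB-analogue holds for every S₀ while the
BNC-analogue fails; no-banal world (`bn = False`, the ℓ ≤ n + 1 sector): the BNC-analogue holds while the AUXB-analogue fails.  So neither piece
gives the other, and neither alone is ILC. -/

/-- WORLD «every place banal»: (toy-H♯ ⇒ toy-H♮ for every S₀) ∧ toy-H♮(∅) ∧ ¬ toy-C — AUXB-analogue true, BNC-analogue false. -/
theorem worldAllBanal_separates :
    (∀ S₀ : Set ℕ, BanalLevel.ToySharp BanalLevel.escClose (fun k v => ¬ BanalLevel.escClose k v) S₀ →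
        BanalLevel.ToyFlat BanalLevel.escClose (fun k v => ¬ BanalLevel.escClose k v) (fun _ => True) S₀) ∧
    BanalLevel.ToyFlat BanalLevel.escClose (fun k v => ¬ BanalLevel.escClose k v) (fun _ => True) ∅ ∧
    ¬ BanalLevel.ToyBounded BanalLevel.escClose :=
  BanalLevel.worldA_separates

/-- WORLD «no place banal»: (toy-H♮ ⇒ toy-C for every finite S₀) ∧ toy-H♯(∅) ∧ (toy-H♮ fails for every finite S₀) — BNC-analogue true,
AUXB-analogue false. -/
theorem worldNoBanal_separates :
    (∀ S₀ : Set ℕ, S₀.Finite → BanalLevel.ToyFlat BanalLevel.escClose (fun k v => ¬ BanalLevel.escClose k v) (fun _ => False) S₀ →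
        BanalLevel.ToyBounded BanalLevel.escClose) ∧
    BanalLevel.ToySharp BanalLevel.escClose (fun k v => ¬ BanalLevel.escClose k v) ∅ ∧
    ∀ S₀ : Set ℕ, S₀.Finite → ¬ BanalLevel.ToyFlat BanalLevel.escClose (fun k v => ¬ BanalLevel.escClose k v) (fun _ => False) S₀ :=
  BanalLevel.worldB_separates

/-! ## 9. Relation to the gen-26 decomposition ILC ⟺ BNS ∧ NBC: the two pairs are interchangeable as PAIRS (both are ILC), while the
depths H♮ and H♭ are incomparable — no cross pair composes (BNS ∧ BNC and AUXB ∧ NBC are both silent about ILC) -/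

/-- The gen-26 pair gives this node's pair (through ILC). -/
theorem banalAuxPieces_of_banalLevelPieces (h₁ : BanalLevel.BanalShaping) (h₂ : BanalLevel.NonBanalConfinement) :
    AuxiliaryBanality ∧ BanalConfinement :=
  confinement_iff_banalAuxPieces.mp (BanalLevel.closes_residual h₁ h₂)

/-- This node's pair gives the gen-26 pair (through ILC). -/
theorem banalLevelPieces_of_banalAuxPieces (h₁ : AuxiliaryBanality) (h₂ : BanalConfinement) :
    BanalLevel.BanalShaping ∧ BanalLevel.NonBanalConfinement :=
  BanalLevel.confinement_iff_pieces.mp (closes_residual h₁ h₂)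

/-! ## 10. The frames: parent, root and host deciding theorems with ILC replaced by AUXB, BNC -/

/-- Parent frame: G → SSH → AUXB → BNC → FERN through `AuxiliaryLevelSplit.closes`. -/
theorem closes_parent_banalAux (hG : Summit.Langlands.Langlands.Theses.AuxiliaryLevelSplit.LevelFreeFern) (hS : SemistableShaping)
    (h₁ : AuxiliaryBanality) (h₂ : BanalConfinement) : Summit.Langlands.Langlands.Theses.DepthPrimeSplit.FernSpread :=
  Summit.Langlands.Langlands.Theses.AuxiliaryLevelSplit.closes hG (closes_target3 hS h₁ h₂)

/-- Root frame: the great-grandparent's deciding theorem with FERN replaced by G, SSH, AUXB, BNC (eleven binders → the summit). -/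
theorem closes_root_banalAux (hD : Summit.Langlands.Langlands.Theses.DepthPrimeSplit.DyadicSeed) (hO : Summit.Langlands.Langlands.Theses.DepthPrimeSplit.OddPrimeSeed)
    (hG : Summit.Langlands.Langlands.Theses.AuxiliaryLevelSplit.LevelFreeFern) (hS : SemistableShaping) (h₁ : AuxiliaryBanality) (h₂ : BanalConfinement)
    (hC : Summit.Langlands.Langlands.Theses.DepthPrimeSplit.Classicality) (hW : Summit.Langlands.Langlands.Theses.DepthPrimeSplit.SatakeAvatarExistence)
    (hP : Summit.Langlands.Langlands.Theses.DepthPrimeSplit.PadicMemberCompatibility)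
    (hA : Summit.Langlands.Langlands.Theses.DepthPrimeSplit.CompatibilityAwayFromLR) (hR : Summit.Langlands.Langlands.Theses.DepthPrimeSplit.CanonicalReciprocityData) :
    _root_.Langlands :=
  Summit.Langlands.Langlands.Theses.DepthPrimeSplit.closes hD hO (closes_parent_banalAux hG hS h₁ h₂) hC hW hP hA hR

/-- Host frame (through the landed gen-26/27 DAG edge `DictEdge.levelFiniteness_of_ssHost`): W⁺ → P → SSM → CRD → IWD-A → IWD-B1a → IWD-B1b →
IWD-B2 → AUXB → BNC → U — after this node, U's open content is {AUXB, BNC} plus hosts and dictionary items. -/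
theorem levelFiniteness_of_ssHost_banalAux
    (hW : Summit.Langlands.Langlands.Theses.PrimeSwitchSplit.SatakeAvatarExistence)
    (hP : Summit.Langlands.Langlands.Theses.PrimeSwitchSplit.PadicMemberCompatibility)
    (hSSM : Summit.Langlands.Langlands.Theses.RootDecomp1.SemisimpleMatchingOneDatum)
    (hCRD : Summit.Langlands.Langlands.Theses.PrimeSwitchSplit.CanonicalReciprocityData)
    (hA : DictEdge.IwahoriFixedOfInertiaTrivialParameter) (hB1a : DictEdge.SphericalOfUnramifiedParameter)
    (hB1b : DictEdge.UnramifiedOfSphericalLocalComponent) (hB2 : DictEdge.SatakeOfSphericalLocalGlobal)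
    (h₁ : AuxiliaryBanality) (h₂ : BanalConfinement) :
    Summit.Langlands.Langlands.Theses.AuxiliaryLevelSplit.LevelFiniteness :=
  DictEdge.levelFiniteness_of_ssHost hW hP hSSM hCRD hA hB1a hB1b hB2 (closes_residual h₁ h₂)

#print axioms closes_residual
#print axioms closes_target3
#print axioms confinement_iff_banalAuxPieces
#print axioms levelFiniteness_iff_banalAuxPieces
#print axioms isNonBanalAt_iff_dvd_card_GL
#print axioms banalConfinement_smallPrimes
#print axioms levelFiniteness_of_ssHost_banalAux

end Summit.Langlands.Langlands.Theorems.BanalAuxiliary
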